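import Summits.BirchSwinnertonDyer.BirchSwinnertonDyer.Theorems.PrintCFramBottomClassIndexLawFiveLeFlipRungTwoEightVehicle
import Summits.BirchSwinnertonDyer.BirchSwinnertonDyer.Theorems.PrintCFramBottomClassIndexLawFiveLeFlipRungTwoEightBracket
import Summits.BirchSwinnertonDyer.BirchSwinnertonDyer.Theorems.PrintCFramBottomClassIndexLawFiveLeFlipRungTwoEightBracketMain
import Summits.BirchSwinnertonDyer.BirchSwinnertonDyer.Theorems.PrintCFramBottomClassIndexLawFiveLeFlipRungTwoEightWeights
import Summits.BirchSwinnertonDyer.BirchSwinnertonDyer.Theorems.PrintCFramBottomClassIndexLawFiveLeFlipRungTwoEightOfJML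
import Summits.BirchSwinnertonDyer.BirchSwinnertonDyer.Theorems.PrintCFramBottomClassIndexLawFiveLeFlipRungTwoOddCutCohen
import HarnessLib

/-!
# Crux `PrintCFram.BottomClassIndexLawFiveLe` (stmt-BirchSwinnertonDyer-20372), line `eisenstein-resource-bdp-line` (registry v29 `stub_flipRungs.2`,
# the `8 ∣ m` half): THE 2-ADIC FLIPPED-CUSP RUNG FOR `e = 3` — THE MODULAR ASSEMBLY `jmlTwoEight_six_of_facts : NF-A → NF-Q → (JMLTwoEight⁶)`
# (cell `bsd-print-cfram`, width seat `bsd-line-cfram-p1-w8` g10; THEOREMS ONLY, `--supports` 20372 `--as helper`; BSD is not proved by any of this)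

HONEST FRAMING. Nothing here is a statement about BSD or elliptic curves; no registered stub is closed by this file alone. It ASSEMBLES the kernel
typing of the `8 ∣ m` half of v29's `stub_flipRungs.2` = (FlipRungTwo⁶): w6 g10's modular-free interface (JMLTwoEight⁶) (the `hJML` binder of
`FlipRung.rungTwoEight_six_of_jmlTwoEight`, `…FlipRungTwoEightOfJML`, VERBATIM below) from the two cited facts NF-A (Cohen 1975 Thm 3.1:
`Cohen1975.thm31_cohenSeries_mem_halfIntModularForms`) and NF-Q (Katz 1973 Cor. 1.6.2: `Katz1973_qExpansionPrinciple_allCusps`). THE CHAIN (w8 g10's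
`R = 16` road, HOME/STATUS 11:14:53Z, with w5 g9's square-class remark): `m = 8m₁`; `G` = the AWAY₂′-cut of `H_k` (w7 g9 M1b `exists_awayTwoCut_cohen`
at `m/2`, pattern re-keyed by `J(2|q')`) `∈ M_{(2k+1)/2}(4Q₀², 1)`, `Q₀ = 3m₁²`; `g = G|U_4` (`heckeFun_two_mem_qCoeffs_smul`, `qCoeffs g n = a(4n)`); for an
ODD class `c (mod 8)` the EVEN class `2c (mod 16)` of `g` carries the hypothesis, and the class cut `P = Σ_{j<16} e(−2cj/16)/16·g(· + j/16)` IS a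
half-integral weight form (w5 g9 `classCutSixteen_mem_halfIntModularForms`); the product vehicle `f = P·θ(16·) ∈ ModularForm (Γ₁(1024Q₀²)) (k+1)`,
`≡ 0 (mod p)` at `∞` (w5 g9 `exists_classVehicleSixteen_of_class_hypothesis`); NF-Q at `γ₀ = [[a,b],[Q₀², 256]]` transports to the bracket `B₁₆`
(w4 g20 `exists_isIntegral_bracketSixteen_coeff`, `N = 1024Q₀²`); `c_B(n·N/256) = 16^{−(k+1)}·W(n)·a(4n)` for `4 ∤ n` (w8 g10 P6g
`bracketSixteen_coeff_eq_flipWeight_mul`, on P6c/P6d); `W(n)` is inverted by an algebraic integer on `n ≡ 2 (mod 4)` (w8 g10 P6b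
`exists_isIntegral_mul_flipWeightSixteen_eq_one_of_sq`) ⟹ `a(8n″) = a(4·2n″) ∈ p·ℤ̄[1/N]` for every odd `n″`: ONE STEP, no dead class.

* §1 bookkeeping (`m/2/4 = m/8`, the AWAY₂′ predicate at `m/2` versus at `m`, `p ∤ 1024Q₀²`, the cusp matrix `γ₀`);
* §2 **`jmlTwoEight_six_of_facts`**; §3 `rungTwoEight_six_of_facts` (w6 g10's layer B on top) — the `hEight` slot of v30's `stub_flipRungTwo`.

No definitions, no named facts, no `sorry`. beyond-print theorem: NO (Shimura 1973 §1 bookkeeping + two cited theorems). References: [Cohen1975] Thm 3.1;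
[Katz1973] §1.6 Cor. 1.6.2; [Shimura1973HalfIntegral] §1, Prop. 1.3–1.5; crux notes w7g8-T6 §5; w8 g10 / w5 g9 / w4 g20 / w6 g10 STATUS 2026-08-29.
-/

set_option autoImplicit false
-- summit-side namespace `Summit.BirchSwinnertonDyer.BirchSwinnertonDyer.…` (single-conjunct summit, D-0017 layout)
set_option linter.dupNamespace false

noncomputable section

open scoped Classical NumberTheorySymbols Real MatrixGroups
open UpperHalfPlane hiding I
open Complex CongruenceSubgroup
open Literature.NumberTheory.ModularForms.CohenEisenstein
open Literature.NumberTheory.EllipticCurves.ModularForms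
open Literature.NumberTheory.EllipticCurves.Tunnell1983 (thetaMul)

namespace Summit.BirchSwinnertonDyer.BirchSwinnertonDyer.Theorems.PrintCFram.FlipRung

open Summit.BirchSwinnertonDyer.BirchSwinnertonDyer.Theorems.PrintCFram

/-! ## §1 Bookkeeping -/

/-- For `2 ∣ m` and an odd prime `q'`: `q' ∣ m/2 ↔ q' ∣ m`. [folklore] -/
theorem prime_dvd_div_two_iff {m q' : ℕ} (h2m : 2 ∣ m) (hq' : q'.Prime) (hq'2 : q' ≠ 2) : q' ∣ m / 2 ↔ q' ∣ m := by
  obtain ⟨m', rfl⟩ := h2m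
  rw [Nat.mul_div_cancel_left _ (by norm_num : 0 < 2)]
  refine ⟨fun h ↦ Dvd.dvd.mul_left h 2, fun h ↦ ?_⟩
  rcases (Nat.Prime.dvd_mul hq').mp h with h2 | h2
  · exact absurd ((Nat.prime_dvd_prime_iff_eq hq' Nat.prime_two).mp h2) hq'2
  · exact h2

/-- The AWAY₂′ predicate at `m/2` (M1b's shape) is the AWAY₂′ predicate at `m` ((JMLTwoEight⁶)'s shape). [folklore] -/
theorem awayTwoPrime_iff {m : ℕ} (h2m : 2 ∣ m) (τ : ℕ → ℤ) (i : ℕ) :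
    (m / 2 / 4 ∣ i ∧ (∀ q' : ℕ, q'.Prime → q' ∣ m / 2 → q' ≠ 2 →
        jacobiSym (-((i / (m / 2 / 4) : ℕ) : ℤ)) q' = τ q' * jacobiSym 2 q') ∧ ¬ 3 ∣ i / (m / 2 / 4)) ↔
      (m / 8 ∣ i ∧ (∀ q' : ℕ, q'.Prime → q' ∣ m → q' ≠ 2 →
        jacobiSym (-((i / (m / 8) : ℕ) : ℤ)) q' = τ q' * jacobiSym 2 q') ∧ ¬ 3 ∣ i / (m / 8)) := by
  have h8 : m / 2 / 4 = m / 8 := by rw [Nat.div_div_eq_div_mul]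
  rw [h8]
  refine ⟨fun ⟨h1, h2, h3⟩ ↦ ⟨h1, fun q' hq' hq'm hq'2 ↦ h2 q' hq' ((prime_dvd_div_two_iff h2m hq' hq'2).mpr hq'm) hq'2, h3⟩,
    fun ⟨h1, h2, h3⟩ ↦ ⟨h1, fun q' hq' hq'm hq'2 ↦ h2 q' hq' ((prime_dvd_div_two_iff h2m hq' hq'2).mp hq'm) hq'2, h3⟩⟩

/-- `p ∤ 1024·(3m₁²)²` for a leaf prime `p ≥ 7` (`p ≠ 2, 3`) with `p ∤ m₁`. [folklore] -/
theorem not_dvd_levelSixteen {p m₁ : ℕ} (hp : p.Prime) (hp2 : p ≠ 2) (hp3 : p ≠ 3) (hpm : ¬ p ∣ m₁) :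
    ¬ p ∣ 1024 * (3 * m₁ ^ 2) ^ 2 := by
  intro h
  rcases (Nat.Prime.dvd_mul hp).mp h with h1 | h1
  · exact hp2 ((Nat.prime_dvd_prime_iff_eq hp Nat.prime_two).mp (Nat.Prime.dvd_of_dvd_pow hp (show p ∣ 2 ^ 10 by simpa using h1)))
  · have h2 := Nat.Prime.dvd_of_dvd_pow hp h1
    rcases (Nat.Prime.dvd_mul hp).mp h2 with h3 | h3
    · exact hp3 ((Nat.prime_dvd_prime_iff_eq hp Nat.prime_three).mp h3)
    · exact hpm (Nat.Prime.dvd_of_dvd_pow hp h3)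

/-- The cusp matrix `γ₀ = [[a, b],[M, 256]] ∈ SL₂(ℤ)` exists for `M` odd. [folklore] -/
theorem exists_cuspMatrix_twofiftysix {M : ℕ} (hM : Odd M) :
    ∃ (γ₀ : SL(2, ℤ)) (a b : ℤ), 256 * a - (M : ℤ) * b = 1 ∧
      (γ₀ 0 0 : ℤ) = a ∧ (γ₀ 0 1 : ℤ) = b ∧ (γ₀ 1 0 : ℤ) = M ∧ (γ₀ 1 1 : ℤ) = 256 := by
  have hMZ : Odd (M : ℤ) := by exact_mod_cast hM
  obtain ⟨a, b, hdet⟩ := exists_det_sixteen hMZ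
  exact ⟨⟨!![a, b; (M : ℤ), 256], by rw [Matrix.det_fin_two_of]; linear_combination hdet⟩, a, b, hdet, rfl, rfl, rfl, rfl⟩

/-- `16^{k+1}·u·(p·y)`-bookkeeping: if `c = 16^{−(k+1)}·W·x`, `u·W = 1` with `u` integral and `c ∈ p·ℤ̄[1/N]`, then `x ∈ p·ℤ̄[1/N]`. [folklore] -/
theorem mem_of_coeff_eq_inv_pow_mul {N p k : ℕ} {c W x u : ℂ} (hc : c = ((16 : ℂ)⁻¹) ^ (k + 1) * W * x) (hu : IsIntegral ℤ u)
    (huW : u * W = 1) (hmem : ∃ y : ℂ, (∃ j : ℕ, IsIntegral ℤ ((N : ℂ) ^ j * y)) ∧ c = (p : ℂ) * y) :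
    ∃ y : ℂ, (∃ j : ℕ, IsIntegral ℤ ((N : ℂ) ^ j * y)) ∧ x = (p : ℂ) * y := by
  obtain ⟨y, ⟨j, hj⟩, hcy⟩ := hmem
  refine ⟨(16 : ℂ) ^ (k + 1) * u * y, ⟨j, ?_⟩, ?_⟩
  · have h16 : IsIntegral ℤ ((16 : ℂ) ^ (k + 1) * u) := by
      have : IsIntegral ℤ ((16 : ℂ)) := by exact_mod_cast isIntegral_algebraMap (R := ℤ) (A := ℂ) (x := 16)
      exact (this.pow _).mul hu
    have e : (N : ℂ) ^ j * ((16 : ℂ) ^ (k + 1) * u * y) = ((16 : ℂ) ^ (k + 1) * u) * ((N : ℂ) ^ j * y) := by ring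
    rw [e]
    exact h16.mul hj
  · have h16ne : (16 : ℂ) ^ (k + 1) ≠ 0 := pow_ne_zero _ (by norm_num)
    have hx : x = (16 : ℂ) ^ (k + 1) * u * c := by
      calc x = ((16 : ℂ) ^ (k + 1) * ((16 : ℂ) ^ (k + 1))⁻¹) * (u * W) * x := by rw [mul_inv_cancel₀ h16ne, huW]; ring
        _ = (16 : ℂ) ^ (k + 1) * u * (((16 : ℂ)⁻¹) ^ (k + 1) * W * x) := by rw [inv_pow]; ring
        _ = (16 : ℂ) ^ (k + 1) * u * c := by rw [← hc]
    rw [hx, hcy]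
    ring

/-! ## §2 The assembly -/

/-- **`jmlTwoEight_six_of_facts`: (JMLTwoEight⁶) ⟸ NF-A ∧ NF-Q** — w6 g10's modular-free interface of the `8 ∣ m` half of the 2-adic rung, as
a KERNEL consequence of Cohen 1975 Thm 3.1 and Katz 1973 Cor. 1.6.2 (both cited named facts, taken as hypotheses), through w8 g10's `R = 16`
flipped cusp: for a class datum with `8 ∣ m`, a pattern `τ` and the coefficient function `a = 𝟙_{AWAY₂′}·H(k,·)`, there is `N` (`p ∤ N`, `2 ∣ N`)
such that for every odd class `c (mod 8)`: `a(8n) ∈ p·ℤ̄[1/N]` on `n ≡ c (8)` ⟹ `a(8n) ∈ p·ℤ̄[1/N]` for every odd `n`. CONDITIONAL ONLY on the two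
cited facts (hypotheses `hA`, `hKatz`). [cite: Cohen1975, Thm. 3.1] [cite: Katz1973, §1.6 Cor. 1.6.2] [cite: Shimura1973HalfIntegral, Prop. 1.3–1.5] -/
theorem jmlTwoEight_six_of_facts (hA : Literature.NumberTheory.ModularForms.Cohen1975.thm31_cohenSeries_mem_halfIntModularForms)
    (hKatz : Literature.NumberTheory.ModularForms.Katz1973_qExpansionPrinciple_allCusps) :
    ∀ (p : ℕ) [Fact p.Prime] (m : ℕ) [NeZero m] (χ : DirichletCharacter ℚ_[p] m) (k : ℕ),
      (p = 7 ∨ p = 11 ∨ p = 19 ∨ p = 43 ∨ p = 67 ∨ p = 163) →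
      m.Coprime p → χ.IsPrimitive → χ.IsQuadratic → (k = (p + 1) / 4 ∨ k = (3 * p - 1) / 4) →
      2 ≤ k → k ≤ p - 2 → χ (-1) * (-1) ^ k = -1 → 2 ∣ m → 8 ∣ m →
      ∀ (τ : ℕ → ℤ), (∀ q' : ℕ, q'.Prime → q' ∣ m → q' ≠ 2 → (τ q' = 1 ∨ τ q' = -1)) →
      ∀ (a : ℕ → ℚ),
        (∀ i : ℕ, (m / 8 ∣ i ∧
            (∀ q' : ℕ, q'.Prime → q' ∣ m → q' ≠ 2 →
              jacobiSym (-((i / (m / 8) : ℕ) : ℤ)) q' = τ q' * jacobiSym 2 q') ∧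
            ¬ 3 ∣ i / (m / 8)) → a i = cohenH k i) →
        (∀ i : ℕ, ¬ (m / 8 ∣ i ∧
            (∀ q' : ℕ, q'.Prime → q' ∣ m → q' ≠ 2 →
              jacobiSym (-((i / (m / 8) : ℕ) : ℤ)) q' = τ q' * jacobiSym 2 q') ∧
            ¬ 3 ∣ i / (m / 8)) → a i = 0) →
      ∃ N : ℕ, ¬ p ∣ N ∧ 2 ∣ N ∧
        ∀ c : ℕ, c % 2 = 1 →
          (∀ n : ℕ, n % 8 = c % 8 →
            ∃ y : ℂ, (∃ j : ℕ, IsIntegral ℤ ((N : ℂ) ^ j * y)) ∧ ((a (8 * n) : ℚ) : ℂ) = (p : ℂ) * y) →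
          ∀ n : ℕ, n % 2 = 1 →
            ∃ y : ℂ, (∃ j : ℕ, IsIntegral ℤ ((N : ℂ) ^ j * y)) ∧ ((a (8 * n) : ℚ) : ℂ) = (p : ℂ) * y := by
  intro p hp m _ χ k hp6 hmp hχ hχq _hk hk2 _hkp _hpar h2m h8m τ _hτ a ha1 ha0
  have hpprime : p.Prime := hp.out
  have hp2 : p ≠ 2 := by rcases hp6 with h | h | h | h | h | h <;> omega
  have hp3 : p ≠ 3 := by rcases hp6 with h | h | h | h | h | h <;> omega
  -- `m = 8m₁`, `m₁ = m/8 = m/2/4` odd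
  have hm₁odd : m / 8 % 2 = 1 := eight_dvd_conductor_odd_quotient hχ hχq h8m
  have h84 : m / 2 / 4 = m / 8 := by rw [Nat.div_div_eq_div_mul]
  have h4m' : 4 ∣ m / 2 := by
    obtain ⟨r, hr⟩ := h8m
    exact ⟨r, by rw [hr]; omega⟩
  have hm1 : 0 < m / 2 / 4 := by rw [h84]; omega
  -- the AWAY₂′ cut of `H_k` (M1b at `m/2`, pattern `τ·J(2|·)`) and its `U_4`-image
  obtain ⟨G, hG, hGq⟩ := exists_awayTwoCut_cohen hA hk2 (m / 2) (fun q' ↦ τ q' * jacobiSym 2 q') h4m' hm1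
  set Q₀ : ℕ := 3 * (m / 2 / 4) ^ 2 with hQ₀def
  have hQ₀odd : Odd Q₀ := by
    rw [hQ₀def, h84]
    exact Nat.odd_mul.mpr ⟨by decide, (Nat.odd_iff.mpr hm₁odd).pow⟩
  have hModd : Odd (Q₀ ^ 2) := hQ₀odd.pow
  have hMpos : 0 < Q₀ ^ 2 := hModd.pos
  haveI : NeZero (Q₀ ^ 2) := ⟨hMpos.ne'⟩
  haveI : NeZero (4 * Q₀ ^ 2) := ⟨by positivity⟩
  have h4N : 4 ∣ 4 * Q₀ ^ 2 := dvd_mul_right 4 _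
  have hGa : ∀ i : ℕ, qCoeffs G i = ((a i : ℚ) : ℂ) := by
    intro i
    rw [hGq i]
    by_cases hi : (m / 8 ∣ i ∧ (∀ q' : ℕ, q'.Prime → q' ∣ m → q' ≠ 2 →
        jacobiSym (-((i / (m / 8) : ℕ) : ℤ)) q' = τ q' * jacobiSym 2 q') ∧ ¬ 3 ∣ i / (m / 8))
    · rw [if_pos ((awayTwoPrime_iff h2m τ i).mpr hi), ha1 i hi]
    · rw [if_neg (fun h ↦ hi ((awayTwoPrime_iff h2m τ i).mp h)), ha0 i hi]; push_cast; rfl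
  obtain ⟨hg, hgq, -⟩ := heckeFun_two_mem_qCoeffs_smul h4N ⟨k, rfl⟩ hG
  set g : ℍ → ℂ := @heckeFun (2 * k + 1) (4 * Q₀ ^ 2) (1 : DirichletCharacter ℂ (4 * Q₀ ^ 2)) 2 ⟨Nat.prime_two⟩ G with hgdef
  have hga : ∀ n : ℕ, qCoeffs g n = ((a (4 * n) : ℚ) : ℂ) := fun n ↦ by rw [hgq n, hGa]
  -- the level `N = 1024·Q₀²`
  set N : ℕ := 1024 * Q₀ ^ 2 with hNdef
  have hpm₁ : ¬ p ∣ m / 8 := fun h ↦ by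
    have hpm : p ∣ m := dvd_trans h (Nat.div_dvd_of_dvd h8m)
    have := Nat.Coprime.eq_one_of_dvd (Nat.Coprime.symm hmp) hpm
    exact hpprime.one_lt.ne' this
  have hpN : ¬ p ∣ N := by rw [hNdef, hQ₀def, h84]; exact not_dvd_levelSixteen hpprime hp2 hp3 hpm₁
  have h2N : 2 ∣ N := ⟨512 * Q₀ ^ 2, by rw [hNdef]; ring⟩
  have hN0 : 0 < N := by rw [hNdef]; positivity
  have hN3 : 3 ≤ N := by rw [hNdef]; have := hMpos; omega
  have h1024 : 1024 ∣ N := ⟨Q₀ ^ 2, rfl⟩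
  have h256 : 256 ∣ N := dvd_trans (by norm_num) h1024
  have hMN : Q₀ ^ 2 ∣ N := ⟨1024, by rw [hNdef]; ring⟩
  have hLN : 4 * Q₀ ^ 2 * 16 ^ 2 ∣ N := ⟨1, by rw [hNdef]; ring⟩
  have hNP : ((4 * Q₀ ^ 2 * 16 ^ 2 : ℕ) : ℤ) ∣ 1024 * ((Q₀ ^ 2 : ℕ) : ℤ) := ⟨1, by push_cast; ring⟩
  -- the cusp matrix `γ₀ = [[a₀, b₀],[Q₀², 256]]` and the solutions `y_j`
  obtain ⟨γ₀, a₀, b₀, hdet, h00, h01, h10, h11⟩ := exists_cuspMatrix_twofiftysix hModd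
  have hsol : ∀ j : ℕ, ∃ y : ℤ, Odd (j : ℤ) → (j : ℤ) * ((Q₀ ^ 2 : ℕ) : ℤ) * y ≡ b₀ [ZMOD 16] := by
    intro j
    by_cases hj : Odd (j : ℤ)
    · obtain ⟨y, hy⟩ := exists_solution_sixteen hdet hj
      exact ⟨y, fun _ ↦ hy⟩
    · exact ⟨0, fun h ↦ absurd h hj⟩
  choose y hy using hsol
  have hodd : ∀ j ∈ ({1, 3, 5, 7, 9, 11, 13, 15} : Finset ℕ), Odd (j : ℤ) := by
    intro j hj
    simp only [Finset.mem_insert, Finset.mem_singleton] at hj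
    rcases hj with rfl | rfl | rfl | rfl | rfl | rfl | rfl | rfl <;> decide
  have hyS : ∀ j ∈ ({1, 3, 5, 7, 9, 11, 13, 15} : Finset ℕ), (j : ℤ) * ((Q₀ ^ 2 : ℕ) : ℤ) * y j ≡ b₀ [ZMOD 16] :=
    fun j hj ↦ hy j (hodd j hj)
  have hyS' : ∀ j ∈ ({1, 3, 5, 7, 9, 11, 13, 15} : Finset ℕ), ((Q₀ ^ 2 : ℕ) : ℤ) ^ 2 * (j : ℤ) * y j ≡ -1 [ZMOD 16] :=
    fun j hj ↦ sq_mul_mul_modEq_neg_one_sixteen hdet (hyS j hj)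
  refine ⟨N, hpN, h2N, fun c hc hcls n hn ↦ ?_⟩
  -- the EVEN class `2c (mod 16)` of `g` carries the hypothesis
  have hc2 : 2 ∣ 2 * c := dvd_mul_right 2 c
  have hclass : ∀ n' : ℕ, n' % 16 = 2 * c % 16 →
      ∃ y : ℂ, (∃ j : ℕ, IsIntegral ℤ ((N : ℂ) ^ j * y)) ∧ qCoeffs g n' = (p : ℂ) * y := by
    intro n' hn'
    have hn'2 : n' = 2 * (n' / 2) := by omega
    have hcls' := hcls (n' / 2) (by omega)
    rw [hga n', show 4 * n' = 8 * (n' / 2) by omega]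
    exact hcls'
  -- the product vehicle and the class cut as a half-integral weight form
  obtain ⟨f, hf, hcoef⟩ := exists_classVehicleSixteen_of_class_hypothesis h4N hg hc2 hclass
  have hP := classCutSixteen_mem_halfIntModularForms h4N hg hc2
  set P : ℍ → ℂ := fun z : ℍ ↦ ∑ j ∈ Finset.range 16, cexp (-(2 * π * I * ((2 * c * j : ℕ) : ℂ) / 16)) / 16 *
    g ((((j : ℝ) / 16) +ᵥ z : ℍ)) with hPdef
  have h4L : 4 ∣ 4 * Q₀ ^ 2 * 16 ^ 2 := ⟨Q₀ ^ 2 * 16 ^ 2, by ring⟩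
  -- NF-Q transported to the bracket `B₁₆`
  have hBmem := fun n₂ : ℕ ↦ exists_isIntegral_bracketSixteen_coeff hKatz hModd γ₀ h10 h11 hLN hN3 h1024 hMN f hf h4L hP hNP p hcoef n₂
  obtain ⟨-, hBsum⟩ := bracketSixteen_analytic_and_hasSum h4L hP γ₀ h10 h11 hModd hNP h1024 hN0 (k := k)
  -- the coefficient at the frequency `2n·N/256` is the weight times `a(8n)`
  have hn4 : ¬ 4 ∣ 2 * n := by omega
  have hcoefB := bracketSixteen_coeff_eq_flipWeight_mul hMpos hdet γ₀ h00 h01 h10 h11 y hyS hg (hasSum_qCoeffs hg)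
    (fun j : ℕ ↦ cexp (-(2 * π * I * ((2 * c * j : ℕ) : ℂ) / 16)) / 16) (P := P) (fun z ↦ by rw [hPdef]) h256 hN0
    (cB := fun m' ↦ (qExpansion N (fun z : ℍ ↦ ((16 : ℂ)⁻¹) ^ (k + 1) * (P (γ₀ • z) *
      (Complex.sqrt ((((Q₀ ^ 2 : ℕ) : ℂ) * z + 256) / 16) ^ (2 * k + 1))⁻¹))).coeff m')
    (fun z ↦ by simpa only [smul_eq_mul] using hBsum z) (2 * n) hn4
  -- the weight is a unit (P6b): `c ≡ n ≡ 2 (mod 4)` for the class `2c` and the index `2n`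
  obtain ⟨u, hu, huW⟩ := exists_isIntegral_mul_flipWeightSixteen_eq_one_of_sq (c := 2 * c) (n := 2 * n) hQ₀odd ⟨k, rfl⟩
    (by omega) (by omega) y hyS'
  have hmem := mem_of_coeff_eq_inv_pow_mul hcoefB hu huW (hBmem (2 * n * (N / 256)))
  rw [hga (2 * n), show 4 * (2 * n) = 8 * n by ring] at hmem
  exact hmem

/-! ## §3 Layer B on top: (RungTwo⁶) on `8 ∣ m` from the two cited facts -/

/-- **`rungTwoEight_six_of_facts`: (RungTwo⁶)∣_{8 ∣ m} ⟸ NF-A ∧ NF-Q** — w6 g10's `rungTwoEight_six_of_jmlTwoEight` fed by §2; this is the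
`hEight` slot of `FlipRung.rungTwo_six_of_four_of_eight` / `flipRungTwo_six_of_jmlTwo_of_eight` in LEAD's v30 recipe (C). CONDITIONAL ONLY on the
two cited facts. [cite: Cohen1975, Thm. 3.1] [cite: Katz1973, §1.6 Cor. 1.6.2] -/
theorem rungTwoEight_six_of_facts (hA : Literature.NumberTheory.ModularForms.Cohen1975.thm31_cohenSeries_mem_halfIntModularForms)
    (hKatz : Literature.NumberTheory.ModularForms.Katz1973_qExpansionPrinciple_allCusps) :
    ∀ (p : ℕ) [Fact p.Prime] (m : ℕ) [NeZero m] (χ : DirichletCharacter ℚ_[p] m) (k : ℕ),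
      (p = 7 ∨ p = 11 ∨ p = 19 ∨ p = 43 ∨ p = 67 ∨ p = 163) →
      m.Coprime p → χ.IsPrimitive → χ.IsQuadratic → (k = (p + 1) / 4 ∨ k = (3 * p - 1) / 4) →
      2 ≤ k → k ≤ p - 2 → χ (-1) * (-1) ^ k = -1 → 2 ∣ m → 8 ∣ m →
      ∀ (τ : ℕ → ℤ), (∀ q' : ℕ, q'.Prime → q' ∣ m → q' ≠ 2 → (τ q' = 1 ∨ τ q' = -1)) →
      (∀ a : ℕ, m ∣ a → a / m % 4 = 3 →
        (∀ q' : ℕ, q'.Prime → q' ∣ m → q' ≠ 2 → jacobiSym (-((a / m : ℕ) : ℤ)) q' = τ q') →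
        a / m % 8 = 7 → ¬ 3 ∣ a / m → ‖((cohenH k a : ℚ) : ℚ_[p])‖ ≤ (p : ℝ)⁻¹) →
      ∀ a : ℕ, m ∣ a → a / m % 4 = 3 →
        (∀ q' : ℕ, q'.Prime → q' ∣ m → q' ≠ 2 → jacobiSym (-((a / m : ℕ) : ℤ)) q' = τ q') →
        a / m % 8 = 3 → ¬ 3 ∣ a / m → ‖((cohenH k a : ℚ) : ℚ_[p])‖ ≤ (p : ℝ)⁻¹ :=
  rungTwoEight_six_of_jmlTwoEight (jmlTwoEight_six_of_facts hA hKatz)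

end Summit.BirchSwinnertonDyer.BirchSwinnertonDyer.Theorems.PrintCFram.FlipRung

end
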